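import Literature.MathematicalPhysics.QuantumFieldTheory.OSSkeletonExplicitBounds
import Literature.MathematicalPhysics.QuantumFieldTheory.OSSkeletonPullback
import Literature.MathematicalPhysics.QuantumFieldTheory.OSSkeletonVAnalyticity
import Literature.MathematicalPhysics.QuantumFieldTheory.OSLogSlotExplicit
import Literature.Analysis.Complex.LogSectorExtension
import Literature.Analysis.Complex.AnalyticDeconvolution
import HarnessLib

/-!
# The holomorphic density of the skeleton distribution (OS II, Thm. 4.1 pointwise, Method B + Ch. VI.1)

Topic `Literature/MathematicalPhysics/QuantumFieldTheory`; sequel of `OSSkeletonPullback`,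
`OSSkeletonVAnalyticity`, `OSLogSlotExplicit`, `OSSkeletonExplicitBounds`. Osterwalder–Schrader II
prove the real analyticity of the Schwinger functions (Thm. 4.1/4.1') by continuing the
*regularised* Schwinger functions `S_k(ζ + u·e | h)` — the Schwinger function smeared with profiles
of width `w` — analytically in the directional variables `u` (Ch. V.1, (5.7)–(5.8)), with bounds that
are inverse powers of the width (Ch. VI.1, (6.12)–(6.13), from E0'), and then removing the
regularisation. This file carries out the removal for the **skeleton distribution**
`T = 𝔖_{k+2} ∘ skelPullback` of `OSSkeletonPullback` by the tree's analytic deconvolution lemma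
(`Literature.Analysis.Complex.exists_holomorphic_density_of_scaled_regularisations`, which replaces
OS's maximum-principle argument of Ch. VI.1 and tolerates the polynomial blow-up in the width):

* the kernel family is `skelFamily` (each point smeared by its own profile), closed under the binary
  coordinate splitting (`coordMul_skelFamily`) and under scaling
  (`scaleKernel_skelFamily`: scaling the kernel = scaling every profile);
* for profiles `κ_w = scaleKernel w κ` the regularised distribution has the density
  `U ↦ 𝒮[κ_w](tail U)` (`skelDist_translationAverage_tensor`), which by the logarithmic-slot engine
  (`LogSlot.l1TubeExtension_logT_spec`, fed with the explicit E0' slot bounds of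
  `OSSkeletonExplicitBounds`) and the sector extension (`logSectorExt`) extends holomorphically to a
  complex neighbourhood of every parameter point with positive directional coordinates, with a bound
  `C · w^{-p}` (`regG`, `norm_regG_le`, `differentiableOn_regG`, `continuousOn_regG`, `skelDist_regG`);
* **main theorem** `exists_holomorphic_density_skelDist`: near every parameter point `x₀` with
  positive directional coordinates the skeleton distribution `T` has a holomorphic density `H`:
  `T ψ = ∫ H(x) ψ(x) dx` for `ψ` supported near `x₀`.

## References

* K. Osterwalder, R. Schrader, *Axioms for Euclidean Green's functions II*, Comm. Math. Phys.
  42 (1975) 281–305, Thm. 4.1, Ch. V.1 (5.6)–(5.8), Ch. VI.1 (6.5)–(6.13). [OsterwalderSchraderCMP1975]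
-/

noncomputable section

open MeasureTheory Set Filter Module Metric
open _root_.Topology
open scoped InnerProductSpace RealInnerProductSpace SchwartzMap NNReal Real

namespace Literature.MathematicalPhysics.QuantumFieldTheory

open Literature.MathematicalPhysics.QuantumLattice (SchwingerFamily IsPositiveTimeMulti schwartzNorm)
open Literature.MathematicalPhysics.QuantumLattice.SchwingerFamily
open Literature.MathematicalPhysics.QuantumLattice.SchwingerFamily.OSSpace
open Literature.Analysis.FunctionSpaces.SchwartzAverage
open Literature.Analysis.Distribution
open Literature.Analysis.Complex

variable {d : ℕ}

/-! ### Kernels: scaling and homogeneity -/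

section Kernels

variable {k : ℕ} (ê : Fin d → EuclideanSpace ℝ (Fin d)) (hli : LinearIndependent ℝ ê)

/-- **Scaling a kernel of the skeleton family scales every profile**:
`(c · skelKernel (⊗ⱼ κⱼ))_w = c · skelKernel (⊗ⱼ (κⱼ)_w)` (`dim = (k+2) d = ∑ⱼ d`). [folklore] -/
theorem scaleKernel_skelFamily (w : ℝ) (c : ℂ) (κ : Fin (k + 2) → 𝓢(EuclideanSpace ℝ (Fin d), ℂ)) :
    scaleKernel w (skelFamily ê hli (c, κ)) = skelFamily ê hli (c, fun j => scaleKernel w (κ j)) := by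
  by_cases hw : w = 0
  · subst hw; simp [scaleKernel]
  ext U
  rw [scaleKernel_apply hw, skelFamily_apply, skelFamily_apply]
  simp only [scaleKernel_apply hw, map_smul, Pi.smul_apply, Complex.real_smul, finrank_euclideanSpace,
    Fintype.card_prod, Fintype.card_fin, Finset.prod_mul_distrib, Finset.prod_const, Finset.card_univ]
  push_cast
  rw [pow_mul, ← inv_pow]
  ring

variable {V : Type*} [NormedAddCommGroup V] [InnerProductSpace ℝ V] [FiniteDimensional ℝ V]
  [MeasurableSpace V] [BorelSpace V]

/-- The averaging operator is homogeneous in the kernel. [folklore] -/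
theorem translationAverage_id_smul_kernel (c : ℂ) (h u : 𝓢(V, ℂ)) :
    translationAverage (ContinuousLinearMap.id ℝ V) (c • h) u =
      c • translationAverage (ContinuousLinearMap.id ℝ V) h u := by
  ext x
  rw [smul_apply, translationAverage_id_apply, translationAverage_id_apply, smul_eq_mul, ← integral_const_mul]
  refine integral_congr_ae (Eventually.of_forall fun a => ?_)
  simp only [smul_apply, smul_eq_mul, mul_assoc]

end Kernels

/-! ### Tail coordinates -/

section Tail

variable [NeZero d] {k : ℕ}

/-- The coordinate `(i+1, μ)` of the slot `j ↔ (i, μ)`. [folklore] -/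
def tailIdx (k d : ℕ) [NeZero d] (j : Fin (slotK k d + 1)) : Fin (k + 2) × Fin d :=
  ((slotEquiv k d j).1.succ, (slotEquiv k d j).2)

/-- The tail coordinates of a real parameter point, indexed by slots. [folklore] -/
def tailR (x : EuclideanSpace ℝ (Fin (k + 2) × Fin d)) : Fin (slotK k d + 1) → ℝ := fun j => x (tailIdx k d j)

/-- The tail coordinates of a complex parameter point, indexed by slots. [folklore] -/
def tailC (z : Fin (k + 2) × Fin d → ℂ) : Fin (slotK k d + 1) → ℂ := fun j => z (tailIdx k d j)

/-- The reindexed tail coordinates are the tail blocks. [folklore] -/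
theorem reindexV_tailR (x : EuclideanSpace ℝ (Fin (k + 2) × Fin d)) : reindexV (tailR x) = tailBlocks x := by
  funext p
  simp only [reindexV, tailR, tailIdx, tailBlocks, Equiv.apply_symm_apply]

/-- Complex tail coordinates of a real point. [folklore] -/
theorem tailC_eRealPt (x : EuclideanSpace ℝ (Fin (k + 2) × Fin d)) :
    tailC (eRealPt x) = fun j => ((tailR x j : ℝ) : ℂ) := rfl

/-- `tailC` is continuous. [folklore] -/
theorem continuous_tailC : Continuous (tailC (k := k) (d := d)) :=
  continuous_pi fun j => continuous_apply (tailIdx k d j)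

/-- `tailC` is `ℂ`-differentiable (it is linear). [folklore] -/
theorem differentiable_tailC : Differentiable ℂ (tailC (k := k) (d := d)) :=
  differentiable_pi.2 fun j => differentiable_apply (𝕜 := ℂ) (tailIdx k d j)

/-- `tailC` is `1`-Lipschitz for the sup norms. [folklore] -/
theorem norm_tailC_sub_le (z z' : Fin (k + 2) × Fin d → ℂ) : ‖tailC z - tailC z'‖ ≤ ‖z - z'‖ :=
  (pi_norm_le_iff_of_nonneg (norm_nonneg _)).2 fun j => norm_le_pi_norm (z - z') (tailIdx k d j)

/-- `tailC` maps balls into balls. [folklore] -/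
theorem tailC_mem_ball {z₀ z : Fin (k + 2) × Fin d → ℂ} {ρ : ℝ} (hz : z ∈ ball z₀ ρ) : tailC z ∈ ball (tailC z₀) ρ := by
  rw [mem_ball, dist_eq_norm] at hz ⊢
  exact lt_of_le_of_lt (norm_tailC_sub_le z z₀) hz

/-- Near a point whose tail coordinates dominate the radius, the tail coordinates stay positive. [folklore] -/
theorem tailR_pos_of_mem_ball {x₀ x : EuclideanSpace ℝ (Fin (k + 2) × Fin d)} {ρ : ℝ}
    (hx : x ∈ Metric.ball x₀ ρ) (hρ : ∀ j, ρ ≤ tailR x₀ j) (j : Fin (slotK k d + 1)) : 0 < tailR x j := by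
  have h := mem_ball.1 hx
  rw [dist_eq_norm] at h
  have h1 : |x (tailIdx k d j) - x₀ (tailIdx k d j)| < ρ := by
    refine lt_of_le_of_lt ?_ h
    have h2 := PiLp.norm_apply_le (x - x₀) (tailIdx k d j)
    simpa using h2
  have h3 := hρ j
  simp only [tailR] at h3 ⊢
  have h4 := (abs_lt.1 h1).1
  linarith

end Tail

/-! ### The maximal slot bound is sub-linear in the slot constants -/

section SlotBmax

variable {k : ℕ}

/-- `slotBmax` is sub-linear in a common factor of the slot constants. [folklore] -/
theorem LogSlot.slotBmax_const_mul_le {c : ℝ} (hc : 0 ≤ c) (b : ℝ) (C : Fin (k + 1) → ℝ) (N : Fin (k + 1) → ℕ) :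
    LogSlot.slotBmax b (fun i => c * C i) N ≤ c * LogSlot.slotBmax b C N := by
  refine Finset.sup'_le _ _ fun i _ => ?_
  rw [LogSlot.slotB_const_mul]
  exact mul_le_mul_of_nonneg_left (Finset.le_sup' (fun i => LogSlot.slotB i b (C i) (N i) fun _ (s : ℝ) =>
    Complex.exp (-(b : ℂ) * (s : ℂ) ^ 2)) (Finset.mem_univ i)) hc

/-- `slotBmax` is nonnegative for nonnegative slot constants. [folklore] -/
theorem LogSlot.slotBmax_nonneg (b : ℝ) {C : Fin (k + 1) → ℝ} (hC : ∀ i, 0 ≤ C i) (N : Fin (k + 1) → ℕ) :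
    0 ≤ LogSlot.slotBmax b C N :=
  Finset.le_sup'_of_le _ (Finset.mem_univ 0) (LogSlot.slotB_nonneg 0 b (hC 0) (N 0) _)

end SlotBmax

/-! ### The logarithmic-slot data of the skeleton with explicit constants -/

section SlotData

variable [NeZero d] (𝔖 : SchwingerFamily (EuclideanSpace ℝ (Fin d))) (hE1 : 𝔖.IsEuclideanCovariant)
  (hE2 : 𝔖.IsOSReflectionPositive) {k : ℕ}
  (ξ : Fin (k + 1) → EuclideanSpace ℝ (Fin d)) (ê : Fin d → EuclideanSpace ℝ (Fin d)) {g r₀ : ℝ}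
  (hê1 : ∀ μ, ‖ê μ‖ = 1) (hêê : ∀ μ ν, 0 ≤ ⟪ê μ, ê ν⟫) (hξ : ∀ μ i', g ≤ ⟪ê μ, ξ i'⟫)
  (hg : 2 * r₀ < g) (hr₀ : 0 ≤ r₀)

omit [NeZero d] in
/-- The product of the Schwartz norms of the profiles. [folklore] -/
def profProd (M : ℕ) (φ : Fin (k + 2) → 𝓢(EuclideanSpace ℝ (Fin d), ℂ)) : ℝ := ∏ J, schwartzNorm M (φ J)

omit [NeZero d] in
/-- `profProd ≥ 0`. [folklore] -/
theorem profProd_nonneg (M : ℕ) (φ : Fin (k + 2) → 𝓢(EuclideanSpace ℝ (Fin d), ℂ)) : 0 ≤ profProd M φ :=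
  Finset.prod_nonneg fun J _ => QuantumLattice.schwartzNorm_nonneg M (φ J)

variable (g) in
/-- **The unit slot constants**: for the slot `j ↔ (i, μ)`,
`C_{n_L} C_{n_R} (2^{M+1})² (2^{M+1})^{k+2} slotPosConst^{2M}` (the slot bound of
`norm_slotExtV_le_of_vectorBound` per unit of `∏ⱼ |φⱼ|_M`). [folklore] -/
def unitSlotC (Cv : ℕ → ℝ) (M : ℕ) (j : Fin (slotK k d + 1)) : ℝ :=
  Cv (nL (slotEquiv k d j).1) * Cv (nR (slotEquiv k d j).1) *
    ((2 ^ (M + 1)) ^ 2 * (2 ^ (M + 1)) ^ (k + 2) * slotPosConst ξ ê g ^ (M + M))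

/-- `unitSlotC ≥ 0`. [folklore] -/
theorem unitSlotC_nonneg {Cv : ℕ → ℝ} (hCv : ∀ n, 0 ≤ Cv n) (M : ℕ) (j : Fin (slotK k d + 1)) :
    0 ≤ unitSlotC ξ ê g Cv M j := by
  unfold unitSlotC
  have h0 : 0 ≤ slotPosConst ξ ê g := zero_le_one.trans (one_le_slotPosConst ξ ê g)
  have h1 := hCv (nL (slotEquiv k d j).1)
  have h2 := hCv (nR (slotEquiv k d j).1)
  positivity

variable (g) in
/-- **The unit maximal slot bound** `slotBmax 1 unitSlotC (2M)`. [folklore] -/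
def unitSlotBmax (Cv : ℕ → ℝ) (M : ℕ) : ℝ := LogSlot.slotBmax 1 (unitSlotC ξ ê g Cv M) fun _ => M + M

/-- `unitSlotBmax ≥ 0`. [folklore] -/
theorem unitSlotBmax_nonneg {Cv : ℕ → ℝ} (hCv : ∀ n, 0 ≤ Cv n) (M : ℕ) : 0 ≤ unitSlotBmax ξ ê g Cv M :=
  LogSlot.slotBmax_nonneg 1 (unitSlotC_nonneg ξ ê hCv M) _

omit [NeZero d] in
/-- **The unit tube constant** `l1TubeBound (π/2) 1 0 (K+1) 1 0 c`. [folklore] -/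
def unitTubeConst (K : ℕ) (c : ℝ) : ℝ := l1TubeBound (π / 2) 1 0 (K + 1) (fun _ => 1) (fun _ => 0) c

omit [NeZero d] in
/-- `unitTubeConst ≥ 0`. [folklore] -/
theorem unitTubeConst_nonneg (K : ℕ) (c : ℝ) : 0 ≤ unitTubeConst K c := l1TubeBound_one_nonneg _ _ _ _ _ _

omit [NeZero d] in
/-- The constant of the skeleton bound per unit of `C₀ ∏ⱼ |φⱼ|_{s₀}`. [folklore] -/
def skelQ (s₀ : ℕ) : ℝ := 2 ^ (s₀ + 1) * (2 ^ (s₀ + 1)) ^ (k + 2) * skelPosConst ξ ê ^ s₀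

omit [NeZero d] in
/-- `skelQ ≥ 0`. [folklore] -/
theorem skelQ_nonneg (s₀ : ℕ) : 0 ≤ skelQ ξ ê s₀ := by
  unfold skelQ skelPosConst; positivity

/-- **The reindexed skeleton through the profiles.** [folklore] -/
theorem norm_skelSVr_le (φ : Fin (k + 2) → 𝓢(EuclideanSpace ℝ (Fin d), ℂ)) {s₀ : ℕ} {C₀ : ℝ} (hC₀ : 0 ≤ C₀)
    (hσ : ∀ F : 𝓢((Fin (k + 2) → EuclideanSpace ℝ (Fin d)), ℂ), ‖𝔖 (k + 2) F‖ ≤ C₀ * schwartzNorm s₀ F)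
    (v : Fin (slotK k d + 1) → ℝ) :
    ‖skelSVr 𝔖 φ ξ ê v‖ ≤ C₀ * skelQ ξ ê s₀ * profProd s₀ φ * (1 + ‖v‖) ^ s₀ := by
  unfold skelSVr skelQ profProd
  have h := norm_skelSV_le_of_bound 𝔖 φ ξ ê hC₀ hσ (reindexV v)
  rw [norm_reindexV] at h
  exact h.trans (le_of_eq (by ring))

/-- **The slot functions through the profiles** (hypothesis `hCN` of the logarithmic-slot engine, with
the explicit constants `profProd M φ · unitSlotC j`). [cite: OsterwalderSchraderCMP1975, Ch. VI.1 p. 297] -/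
theorem norm_slotEr_le (φ : Fin (k + 2) → 𝓢(EuclideanSpace ℝ (Fin d), ℂ))
    (hφ : ∀ j, tsupport (φ j : EuclideanSpace ℝ (Fin d) → ℂ) ⊆ Metric.closedBall 0 r₀)
    {s : ℕ} {Cv : ℕ → ℝ} (hCv : ∀ n, 0 ≤ Cv n)
    (hv : ∀ (n : ℕ) (K : 𝓢((Fin n → EuclideanSpace ℝ (Fin d)), ℂ)) (hK : IsPositiveTimeMulti K),
      ‖ι 𝔖 hE2 (δ 𝔖 hE2 (mkGen K hK))‖ ≤ Cv n * schwartzNorm ((n + n) * s) K)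
    {M : ℕ} (hM : (k + 1 + (k + 1)) * s ≤ M) (j : Fin (slotK k d + 1)) (v' : Fin (slotK k d) → ℝ) {τ : ℂ}
    (hτ : 0 ≤ τ.re) :
    ‖slotEr 𝔖 hE1 hE2 φ ξ ê hφ hê1 hêê hξ hg hr₀ j v' τ‖ ≤
      profProd M φ * unitSlotC ξ ê g Cv M j * (1 + ‖v'‖) ^ (M + M) := by
  unfold slotEr
  have hi := (slotEquiv k d j).1.isLt
  have hML : (nL (slotEquiv k d j).1 + nL (slotEquiv k d j).1) * s ≤ M := by
    refine le_trans (Nat.mul_le_mul_right _ ?_) hM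
    simp only [nL]; omega
  have hMR : (nR (slotEquiv k d j).1 + nR (slotEquiv k d j).1) * s ≤ M := by
    refine le_trans (Nat.mul_le_mul_right _ ?_) hM
    simp only [nR]; omega
  have h := norm_slotExtV_le_of_vectorBound 𝔖 hE1 hE2 φ ξ ê (slotEquiv k d j).1 (slotEquiv k d j).2 hφ
    (hê1 _) (hêê _) (hξ _) hg hr₀ hCv hv hML hMR (reindexV (j.insertNth (0 : ℝ) v')) hτ
  rw [norm_reindexV, norm_insertNth_zero] at h
  unfold profProd unitSlotC
  exact h.trans (le_of_eq (by ring))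

/-- The slot functions at real points are the reindexed skeleton (hypothesis `hES`). [folklore] -/
theorem slotEr_ofReal (φ : Fin (k + 2) → 𝓢(EuclideanSpace ℝ (Fin d), ℂ))
    (hφ : ∀ j, tsupport (φ j : EuclideanSpace ℝ (Fin d) → ℂ) ⊆ Metric.closedBall 0 r₀)
    (j : Fin (slotK k d + 1)) (v' : Fin (slotK k d) → ℝ) (hv : ∀ l, 0 ≤ v' l) (x : ℝ) (hx : 0 ≤ x) :
    slotEr 𝔖 hE1 hE2 φ ξ ê hφ hê1 hêê hξ hg hr₀ j v' x = skelSVr 𝔖 φ ξ ê (j.insertNth x v') := by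
  have hu : ∀ p, 0 ≤ reindexV (j.insertNth (0 : ℝ) v') p := fun p => insertNth_zero_nonneg j hv _
  rw [slotEr, slotExtV_ofReal 𝔖 hE1 hE2 φ ξ ê _ _ hφ (hê1 _) (hêê _) (hξ _) hg hr₀ hu hx, skelSVr,
    insertNth_eq_update j x v', reindexV_update]

/-- Continuity of the slot functions in the other variables (hypothesis `hEc`). [folklore] -/
theorem continuous_slotEr_left (φ : Fin (k + 2) → 𝓢(EuclideanSpace ℝ (Fin d), ℂ))
    (hφ : ∀ j, tsupport (φ j : EuclideanSpace ℝ (Fin d) → ℂ) ⊆ Metric.closedBall 0 r₀)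
    (j : Fin (slotK k d + 1)) (τ : ℂ) :
    Continuous fun v' => slotEr 𝔖 hE1 hE2 φ ξ ê hφ hê1 hêê hξ hg hr₀ j v' τ :=
  (continuous_slotExtV_left 𝔖 hE1 hE2 φ ξ ê _ _ hφ (hê1 _) (hêê _) (hξ _) hg hr₀ τ).comp
    (continuous_reindexV.comp (Continuous.finInsertNth j continuous_const continuous_id))

/-- Holomorphy of the slot functions (hypothesis `hEd`). [folklore] -/
theorem differentiableOn_slotEr (φ : Fin (k + 2) → 𝓢(EuclideanSpace ℝ (Fin d), ℂ))
    (hφ : ∀ j, tsupport (φ j : EuclideanSpace ℝ (Fin d) → ℂ) ⊆ Metric.closedBall 0 r₀)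
    (j : Fin (slotK k d + 1)) (v' : Fin (slotK k d) → ℝ) :
    DifferentiableOn ℂ (slotEr 𝔖 hE1 hE2 φ ξ ê hφ hê1 hêê hξ hg hr₀ j v') {τ : ℂ | 0 < τ.re} :=
  differentiableOn_slotExtV 𝔖 hE1 hE2 φ ξ ê _ _ hφ (hê1 _) (hêê _) (hξ _) hg hr₀ _

/-- **The logarithmic-slot engine for the profile-smeared skeleton, explicit form**: for
`F = l1TubeExtension 1 (logT 𝒮ᵣ 1)` (`𝒮ᵣ` the reindexed skeleton), holomorphy on `{∑ |Im zⱼ| < π/2}`,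
the bound `‖F z‖ ≤ (∏ⱼ |φⱼ|_M) · unitSlotBmax · unitTubeConst c` on `{∑ |Im zⱼ| ≤ c}`, and the
real-point identity `F(x) = e^{-2∑xⱼ²} 𝒮ᵣ(eˣ)`. [cite: OsterwalderSchraderCMP1975, Ch. V (5.7)–(5.8), Ch. VI.1 (6.12)–(6.13)] -/
theorem l1TubeExtension_logT_skelSVr_spec (hE1 : 𝔖.IsEuclideanCovariant)
    (hê1 : ∀ μ, ‖ê μ‖ = 1) (hêê : ∀ μ ν, 0 ≤ ⟪ê μ, ê ν⟫) (hξ : ∀ μ i', g ≤ ⟪ê μ, ξ i'⟫)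
    (hg : 2 * r₀ < g) (hr₀ : 0 ≤ r₀) (φ : Fin (k + 2) → 𝓢(EuclideanSpace ℝ (Fin d), ℂ))
    (hφ : ∀ j, tsupport (φ j : EuclideanSpace ℝ (Fin d) → ℂ) ⊆ Metric.closedBall 0 r₀)
    {s : ℕ} {Cv : ℕ → ℝ} (hCv : ∀ n, 0 ≤ Cv n)
    (hv : ∀ (n : ℕ) (K : 𝓢((Fin n → EuclideanSpace ℝ (Fin d)), ℂ)) (hK : IsPositiveTimeMulti K),
      ‖ι 𝔖 hE2 (δ 𝔖 hE2 (mkGen K hK))‖ ≤ Cv n * schwartzNorm ((n + n) * s) K)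
    {M : ℕ} (hM : (k + 1 + (k + 1)) * s ≤ M)
    {s₀ : ℕ} {C₀ : ℝ} (hC₀ : 0 ≤ C₀)
    (hσ : ∀ F : 𝓢((Fin (k + 2) → EuclideanSpace ℝ (Fin d)), ℂ), ‖𝔖 (k + 2) F‖ ≤ C₀ * schwartzNorm s₀ F) :
    DifferentiableOn ℂ (l1TubeExtension 1 (LogSlot.logT (skelSVr 𝔖 φ ξ ê) 1))
        {z : Fin (slotK k d + 1) → ℂ | ∑ j, |(z j).im| < π / 2} ∧
      (∀ c : ℝ, c < π / 2 → ∀ z : Fin (slotK k d + 1) → ℂ, ∑ j, |(z j).im| ≤ c →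
        ‖l1TubeExtension 1 (LogSlot.logT (skelSVr 𝔖 φ ξ ê) 1) z‖ ≤
          profProd M φ * unitSlotBmax ξ ê g Cv M * unitTubeConst (slotK k d) c) ∧
      ∀ x : Fin (slotK k d + 1) → ℝ, l1TubeExtension 1 (LogSlot.logT (skelSVr 𝔖 φ ξ ê) 1) (fun j => (x j : ℂ)) =
        LogSlot.logDensity (skelSVr 𝔖 φ ξ ê) 1 x := by
  have hSc : Continuous (skelSVr 𝔖 φ ξ ê) := (continuous_skelSV 𝔖 φ ξ ê).comp continuous_reindexV
  obtain ⟨hF, hK, -, -, hreal⟩ := LogSlot.l1TubeExtension_logT_spec (skelSVr 𝔖 φ ξ ê)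
    (slotEr 𝔖 hE1 hE2 φ ξ ê hφ hê1 hêê hξ hg hr₀) one_pos hSc (norm_skelSVr_le 𝔖 ξ ê φ hC₀ hσ)
    (continuous_slotEr_left 𝔖 hE1 hE2 ξ ê hê1 hêê hξ hg hr₀ φ hφ)
    (differentiableOn_slotEr 𝔖 hE1 hE2 ξ ê hê1 hêê hξ hg hr₀ φ hφ)
    (fun j => profProd M φ * unitSlotC ξ ê g Cv M j) (fun _ => M + M)
    (fun j => mul_nonneg (profProd_nonneg M φ) (unitSlotC_nonneg ξ ê hCv M j))
    (fun j v' _ hτ => norm_slotEr_le 𝔖 hE1 hE2 ξ ê hê1 hêê hξ hg hr₀ φ hφ hCv hv hM j v' hτ)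
    (slotEr_ofReal 𝔖 hE1 hE2 ξ ê hê1 hêê hξ hg hr₀ φ hφ)
  refine ⟨hF, fun c hc z hz => (hK c hc z hz).trans ?_, hreal⟩
  rw [l1TubeBound_const_mul]
  have hL := l1TubeBound_one_nonneg (π / 2) 1 0 (slotK k d + 1) (fun _ => 0) c
  have hB := LogSlot.slotBmax_const_mul_le (profProd_nonneg M φ) 1 (unitSlotC ξ ê g Cv M) (fun _ => M + M)
  unfold unitSlotBmax unitTubeConst
  calc LogSlot.slotBmax 1 (fun j => profProd M φ * unitSlotC ξ ê g Cv M j) (fun _ => M + M) *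
        l1TubeBound (π / 2) 1 0 (slotK k d + 1) (fun _ => 1) (fun _ => 0) c
      ≤ (profProd M φ * LogSlot.slotBmax 1 (unitSlotC ξ ê g Cv M) fun _ => M + M) *
        l1TubeBound (π / 2) 1 0 (slotK k d + 1) (fun _ => 1) (fun _ => 0) c :=
        mul_le_mul_of_nonneg_right hB hL
    _ = _ := by ring

/-- The slot representations of the functional with the explicit constants (hypothesis `hT` of the
flat tube theorems, for the family continuity). [folklore] -/
theorem logT_skelSVr_slot (hE1 : 𝔖.IsEuclideanCovariant)
    (hê1 : ∀ μ, ‖ê μ‖ = 1) (hêê : ∀ μ ν, 0 ≤ ⟪ê μ, ê ν⟫) (hξ : ∀ μ i', g ≤ ⟪ê μ, ξ i'⟫)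
    (hg : 2 * r₀ < g) (hr₀ : 0 ≤ r₀) (φ : Fin (k + 2) → 𝓢(EuclideanSpace ℝ (Fin d), ℂ))
    (hφ : ∀ j, tsupport (φ j : EuclideanSpace ℝ (Fin d) → ℂ) ⊆ Metric.closedBall 0 r₀)
    {s : ℕ} {Cv : ℕ → ℝ} (hCv : ∀ n, 0 ≤ Cv n)
    (hv : ∀ (n : ℕ) (K : 𝓢((Fin n → EuclideanSpace ℝ (Fin d)), ℂ)) (hK : IsPositiveTimeMulti K),
      ‖ι 𝔖 hE2 (δ 𝔖 hE2 (mkGen K hK))‖ ≤ Cv n * schwartzNorm ((n + n) * s) K)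
    {M : ℕ} (hM : (k + 1 + (k + 1)) * s ≤ M)
    {s₀ : ℕ} {C₀ : ℝ} (hC₀ : 0 ≤ C₀)
    (hσ : ∀ F : 𝓢((Fin (k + 2) → EuclideanSpace ℝ (Fin d)), ℂ), ‖𝔖 (k + 2) F‖ ≤ C₀ * schwartzNorm s₀ F)
    (i : Fin (slotK k d + 1)) (θ : Fin (slotK k d + 1) → 𝓢(ℝ, ℂ)) :
    ∃ g' : ℂ → ℂ, DifferentiableOn ℂ g' {z : ℂ | |z.im| < π / 2} ∧
      (∀ c : ℝ, c < π / 2 → ∀ z : ℂ, |z.im| ≤ c →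
        ‖g' z‖ ≤ LogSlot.slotB i 1 (profProd M φ * unitSlotC ξ ê g Cv M i) (M + M) (fun j => ⇑(θ j)) *
          Real.exp (0 * |z.re|)) ∧
      ∀ ϑ : 𝓢(ℝ, ℂ), LogSlot.logT (skelSVr 𝔖 φ ξ ê) 1 (Function.update (fun j => ⇑(θ j)) i ϑ) =
        ∫ s : ℝ, g' s * Complex.exp (-((1 : ℝ) : ℂ) * (s : ℂ) ^ 2) * ϑ s :=
  LogSlot.logT_slot (skelSVr 𝔖 φ ξ ê) (slotEr 𝔖 hE1 hE2 φ ξ ê hφ hê1 hêê hξ hg hr₀) one_pos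
    ((continuous_skelSV 𝔖 φ ξ ê).comp continuous_reindexV) (norm_skelSVr_le 𝔖 ξ ê φ hC₀ hσ)
    (continuous_slotEr_left 𝔖 hE1 hE2 ξ ê hê1 hêê hξ hg hr₀ φ hφ)
    (differentiableOn_slotEr 𝔖 hE1 hE2 ξ ê hê1 hêê hξ hg hr₀ φ hφ)
    (slotEr_ofReal 𝔖 hE1 hE2 ξ ê hê1 hêê hξ hg hr₀ φ hφ) i
    (mul_nonneg (profProd_nonneg M φ) (unitSlotC_nonneg ξ ê hCv M i))
    (fun v' _ hτ => norm_slotEr_le 𝔖 hE1 hE2 ξ ê hê1 hêê hξ hg hr₀ φ hφ hCv hv hM i v' hτ) θ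

end SlotData

/-! ### Scaled profiles -/

section Scaled

variable {k : ℕ}

/-- The scaled profiles `(κⱼ)_w`. [folklore] -/
def scaledProf (κ : Fin (k + 2) → 𝓢(EuclideanSpace ℝ (Fin d), ℂ)) (w : ℝ) :
    Fin (k + 2) → 𝓢(EuclideanSpace ℝ (Fin d), ℂ) := fun j => scaleKernel w (κ j)

/-- Supports of the scaled profiles for `0 < w ≤ 1`. [folklore] -/
theorem tsupport_scaledProf_subset {κ : Fin (k + 2) → 𝓢(EuclideanSpace ℝ (Fin d), ℂ)} {r₀ : ℝ} (hr₀ : 0 ≤ r₀)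
    (hκ : ∀ j, tsupport (κ j : EuclideanSpace ℝ (Fin d) → ℂ) ⊆ Metric.closedBall 0 r₀) {w : ℝ} (hw : w ∈ Ioc (0 : ℝ) 1)
    (j : Fin (k + 2)) : tsupport (scaledProf κ w j : EuclideanSpace ℝ (Fin d) → ℂ) ⊆ Metric.closedBall 0 r₀ :=
  (tsupport_scaleKernel_subset hw.1 (hκ j)).trans (Metric.closedBall_subset_closedBall (by nlinarith [hw.1, hw.2]))

/-- **The profile norms of the scaled profiles**: `∏ⱼ |(κⱼ)_w|_M ≤ w^{-(d+M)(k+2)} ∏ⱼ |κⱼ|_M`. [cite: OsterwalderSchraderCMP1975, Ch. VI.1 (6.12)–(6.13)] -/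
theorem profProd_scaledProf_le (M : ℕ) (κ : Fin (k + 2) → 𝓢(EuclideanSpace ℝ (Fin d), ℂ)) {w : ℝ}
    (hw : w ∈ Ioc (0 : ℝ) 1) :
    profProd M (scaledProf κ w) ≤ (w ^ ((d + M) * (k + 2)))⁻¹ * profProd M κ := by
  unfold profProd scaledProf
  have h1 : ∀ J, schwartzNorm M (scaleKernel w (κ J)) ≤ (w ^ (d + M))⁻¹ * schwartzNorm M (κ J) := fun J => by
    have h := schwartzNorm_scaleKernel_le hw.1 hw.2 (κ J) M
    rwa [finrank_euclideanSpace, Fintype.card_fin] at h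
  calc ∏ J, schwartzNorm M (scaleKernel w (κ J)) ≤ ∏ J : Fin (k + 2), (w ^ (d + M))⁻¹ * schwartzNorm M (κ J) :=
        Finset.prod_le_prod (fun J _ => QuantumLattice.schwartzNorm_nonneg _ _) fun J _ => h1 J
    _ = (w ^ ((d + M) * (k + 2)))⁻¹ * ∏ J, schwartzNorm M (κ J) := by
        rw [Finset.prod_mul_distrib, Finset.prod_const, Finset.card_univ, Fintype.card_fin, pow_mul, inv_pow]

/-- A bound uniform on `[ε, 1]`: `∏ⱼ |(κⱼ)_w|_M ≤ ε^{-(d+M)(k+2)} ∏ⱼ |κⱼ|_M`. [folklore] -/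
theorem profProd_scaledProf_le_of_le (M : ℕ) (κ : Fin (k + 2) → 𝓢(EuclideanSpace ℝ (Fin d), ℂ)) {ε w : ℝ}
    (hε : 0 < ε) (hεw : ε ≤ w) (hw1 : w ≤ 1) :
    profProd M (scaledProf κ w) ≤ (ε ^ ((d + M) * (k + 2)))⁻¹ * profProd M κ := by
  have hw0 : 0 < w := hε.trans_le hεw
  refine (profProd_scaledProf_le M κ ⟨hw0, hw1⟩).trans
    (mul_le_mul_of_nonneg_right ?_ (profProd_nonneg M κ))
  rw [inv_le_inv₀ (by positivity) (by positivity)]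
  exact pow_le_pow_left₀ hε.le hεw _

end Scaled

/-! ### The regularised densities and their holomorphic extensions -/

section Regularised

variable [NeZero d] (𝔖 : SchwingerFamily (EuclideanSpace ℝ (Fin d)))
  (hE2 : 𝔖.IsOSReflectionPositive) {k : ℕ}
  (ξ : Fin (k + 1) → EuclideanSpace ℝ (Fin d)) (ê : Fin d → EuclideanSpace ℝ (Fin d)) {g r₀ : ℝ}

/-- **The explicit holomorphic extension of the regularised skeleton in the logarithmic variables**:
`F_w = l1TubeExtension 1 (logT 𝒮ᵣ[κ_w] 1)`. [cite: OsterwalderSchraderCMP1975, Ch. V.1 (5.8), Ch. VI.1 (6.8)] -/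
def regF (κ : Fin (k + 2) → 𝓢(EuclideanSpace ℝ (Fin d), ℂ)) (w : ℝ) : (Fin (slotK k d + 1) → ℂ) → ℂ :=
  l1TubeExtension 1 (LogSlot.logT (skelSVr 𝔖 (scaledProf κ w) ξ ê) 1)

/-- **The holomorphic densities of the regularised skeleton distribution** (hypothesis `G` of the
analytic deconvolution lemma): `G_{(c, κ)}(w, z) = c · (sector extension of F_w)(tail z)`. [cite: OsterwalderSchraderCMP1975, Ch. VI.1 (6.8)–(6.9)] -/
def regG (a : ℂ × (Fin (k + 2) → 𝓢(EuclideanSpace ℝ (Fin d), ℂ))) (w : ℝ) (z : Fin (k + 2) × Fin d → ℂ) : ℂ :=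
  a.1 * logSectorExt 1 (regF 𝔖 ξ ê a.2 w) (tailC z)

variable (g) in
/-- **The constants of the densities** (hypothesis `C` of the analytic deconvolution lemma). [folklore] -/
def regC (Cv : ℕ → ℝ) (M : ℕ) (x₀ : EuclideanSpace ℝ (Fin (k + 2) × Fin d)) (r : ℝ)
    (a : ℂ × (Fin (k + 2) → 𝓢(EuclideanSpace ℝ (Fin d), ℂ))) : ℝ :=
  ‖a.1‖ * (Real.exp (2 * |(1 : ℝ)| * (slotK k d + 1) * (logRadius (tailR x₀) r + π / 4) ^ 2) *
    (profProd M a.2 * unitSlotBmax ξ ê g Cv M * unitTubeConst (slotK k d) (π / 4)))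

/-- `regC ≥ 0`. [folklore] -/
theorem regC_nonneg {Cv : ℕ → ℝ} (hCv : ∀ n, 0 ≤ Cv n) (M : ℕ) (x₀ : EuclideanSpace ℝ (Fin (k + 2) × Fin d)) (r : ℝ)
    (a : ℂ × (Fin (k + 2) → 𝓢(EuclideanSpace ℝ (Fin d), ℂ))) : 0 ≤ regC ξ ê g Cv M x₀ r a := by
  unfold regC
  have h1 := profProd_nonneg M a.2
  have h2 := unitSlotBmax_nonneg ξ ê (g := g) hCv M
  have h3 := unitTubeConst_nonneg (slotK k d) (π / 4)
  positivity

omit [NeZero d] in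
/-- The tail coordinates of the centre are positive when they dominate a positive radius. [folklore] -/
theorem tailR_centre_pos {x₀ : EuclideanSpace ℝ (Fin (k + 2) × Fin d)} {r : ℝ} (hr : 0 < r) [NeZero d]
    (hrx : ∀ j, r ≤ tailR x₀ j * Real.sin (π / (4 * (slotK k d + 1)))) (j : Fin (slotK k d + 1)) :
    0 < tailR x₀ j ∧ r < tailR x₀ j := by
  have hα0 : 0 < π / (4 * (slotK k d + 1)) := by positivity
  have hα1 : π / (4 * (slotK k d + 1)) ≤ 1 := by
    rw [div_le_one (by positivity)]
    have h1 : (1 : ℝ) ≤ slotK k d + 1 := by simp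
    nlinarith [Real.pi_le_four]
  have hsin0 : 0 < Real.sin (π / (4 * (slotK k d + 1))) :=
    Real.sin_pos_of_pos_of_lt_pi hα0 (hα1.trans_lt (by linarith [Real.two_le_pi]))
  have hsin1 : Real.sin (π / (4 * (slotK k d + 1))) < 1 := (Real.sin_lt hα0).trans_le hα1
  have h := hrx j
  have hu : 0 < tailR x₀ j := by
    by_contra hneg
    push Not at hneg
    nlinarith
  exact ⟨hu, lt_of_le_of_lt h (mul_lt_of_lt_one_right hu hsin1)⟩

variable (hE1 : 𝔖.IsEuclideanCovariant)
  (hê1 : ∀ μ, ‖ê μ‖ = 1) (hêê : ∀ μ ν, 0 ≤ ⟪ê μ, ê ν⟫) (hξ : ∀ μ i', g ≤ ⟪ê μ, ξ i'⟫)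
  (hg : 2 * r₀ < g) (hr₀ : 0 ≤ r₀)
  {s : ℕ} {Cv : ℕ → ℝ} (hCv : ∀ n, 0 ≤ Cv n)
  (hv : ∀ (n : ℕ) (K : 𝓢((Fin n → EuclideanSpace ℝ (Fin d)), ℂ)) (hK : IsPositiveTimeMulti K),
    ‖ι 𝔖 hE2 (δ 𝔖 hE2 (mkGen K hK))‖ ≤ Cv n * schwartzNorm ((n + n) * s) K)
  {M : ℕ} (hM : (k + 1 + (k + 1)) * s ≤ M)
  {s₀ : ℕ} {C₀ : ℝ} (hC₀ : 0 ≤ C₀)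
  (hσ : ∀ F : 𝓢((Fin (k + 2) → EuclideanSpace ℝ (Fin d)), ℂ), ‖𝔖 (k + 2) F‖ ≤ C₀ * schwartzNorm s₀ F)

include hE1 hê1 hêê hξ hg hr₀ hCv hv hM hC₀ hσ

/-- **The regularised extension**: holomorphy on the tube, the bound
`‖F_w ζ‖ ≤ w^{-(d+M)(k+2)} (∏ⱼ |κⱼ|_M) unitSlotBmax unitTubeConst(π/4)` on `{∑ |Im ζⱼ| ≤ π/4}`, and the
real-point identity. [cite: OsterwalderSchraderCMP1975, Ch. VI.1 (6.12)–(6.13)] -/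
theorem regF_spec (κ : Fin (k + 2) → 𝓢(EuclideanSpace ℝ (Fin d), ℂ))
    (hκ : ∀ j, tsupport (κ j : EuclideanSpace ℝ (Fin d) → ℂ) ⊆ Metric.closedBall 0 r₀) {w : ℝ} (hw : w ∈ Ioc (0 : ℝ) 1) :
    DifferentiableOn ℂ (regF 𝔖 ξ ê κ w) {z : Fin (slotK k d + 1) → ℂ | ∑ j, |(z j).im| < π / 2} ∧
      (∀ ζ : Fin (slotK k d + 1) → ℂ, ∑ j, |(ζ j).im| ≤ π / 4 →
        ‖regF 𝔖 ξ ê κ w ζ‖ ≤ (w ^ ((d + M) * (k + 2)))⁻¹ * profProd M κ * unitSlotBmax ξ ê g Cv M *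
          unitTubeConst (slotK k d) (π / 4)) ∧
      ∀ x : Fin (slotK k d + 1) → ℝ, regF 𝔖 ξ ê κ w (fun j => (x j : ℂ)) =
        Complex.exp (-(2 * (1 : ℝ) : ℂ) * ∑ j, (x j : ℂ) ^ 2) *
          skelSVr 𝔖 (scaledProf κ w) ξ ê (fun j => Real.exp (x j)) := by
  obtain ⟨hF, hK, hreal⟩ := l1TubeExtension_logT_skelSVr_spec 𝔖 hE2 ξ ê hE1 hê1 hêê hξ hg hr₀ (scaledProf κ w)
    (tsupport_scaledProf_subset hr₀ hκ hw) hCv hv hM hC₀ hσ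
  refine ⟨hF, fun ζ hζ => (hK (π / 4) (by linarith [Real.pi_pos]) ζ hζ).trans ?_, fun x => ?_⟩
  · have h1 := profProd_scaledProf_le M κ hw
    have h2 := unitSlotBmax_nonneg ξ ê (g := g) hCv M
    have h3 := unitTubeConst_nonneg (slotK k d) (π / 4)
    have h4 : 0 ≤ (w ^ ((d + M) * (k + 2)))⁻¹ * profProd M κ := mul_nonneg (by have := hw.1; positivity) (profProd_nonneg M κ)
    gcongr
  · rw [regF, hreal x]
    rfl

/-- **The bound of the densities** (hypothesis `hbd`): `‖G_a(w, z)‖ ≤ regC a · w^{-(d+M)(k+2)}` on the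
ball of radius `r` about a real point whose tail coordinates dominate `r`. [cite: OsterwalderSchraderCMP1975, Ch. VI.1 (6.13)] -/
theorem norm_regG_le (a : ℂ × (Fin (k + 2) → 𝓢(EuclideanSpace ℝ (Fin d), ℂ)))
    (hκ : ∀ j, tsupport (a.2 j : EuclideanSpace ℝ (Fin d) → ℂ) ⊆ Metric.closedBall 0 r₀) {w : ℝ} (hw : w ∈ Ioc (0 : ℝ) 1)
    (x₀ : EuclideanSpace ℝ (Fin (k + 2) × Fin d)) {r : ℝ} (hr : 0 < r)
    (hrx : ∀ j, r ≤ tailR x₀ j * Real.sin (π / (4 * (slotK k d + 1))))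
    {z : Fin (k + 2) × Fin d → ℂ} (hz : z ∈ ball (eRealPt x₀) r) :
    ‖regG 𝔖 ξ ê a w z‖ ≤ regC ξ ê g Cv M x₀ r a * (w ^ ((d + M) * (k + 2)))⁻¹ := by
  obtain ⟨-, hK, -⟩ := regF_spec 𝔖 hE2 ξ ê hE1 hê1 hêê hξ hg hr₀ hCv hv hM hC₀ hσ a.2 hκ hw
  have hρm : r < Finset.univ.inf' Finset.univ_nonempty (tailR x₀) :=
    (Finset.lt_inf'_iff _).2 fun j _ => (tailR_centre_pos hr hrx j).2
  have hw' : tailC z ∈ ball (fun j => ((tailR x₀ j : ℝ) : ℂ)) r := by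
    rw [← tailC_eRealPt]; exact tailC_mem_ball hz
  have h := norm_logSectorExt_le 1 hK hrx hρm hw'
  unfold regG regC
  rw [norm_mul]
  refine (mul_le_mul_of_nonneg_left h (norm_nonneg _)).trans (le_of_eq ?_)
  ring

/-- **Holomorphy of the densities** (hypothesis `hdiff`). [folklore] -/
theorem differentiableOn_regG (a : ℂ × (Fin (k + 2) → 𝓢(EuclideanSpace ℝ (Fin d), ℂ)))
    (hκ : ∀ j, tsupport (a.2 j : EuclideanSpace ℝ (Fin d) → ℂ) ⊆ Metric.closedBall 0 r₀) {w : ℝ} (hw : w ∈ Ioc (0 : ℝ) 1)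
    (x₀ : EuclideanSpace ℝ (Fin (k + 2) × Fin d)) {r : ℝ}
    (hrx : ∀ j, r ≤ tailR x₀ j * Real.sin (π / (4 * (slotK k d + 1)))) :
    DifferentiableOn ℂ (regG 𝔖 ξ ê a w) (ball (eRealPt x₀) r) := by
  obtain ⟨hF, -, -⟩ := regF_spec 𝔖 hE2 ξ ê hE1 hê1 hêê hξ hg hr₀ hCv hv hM hC₀ hσ a.2 hκ hw
  have hsec : MapsTo tailC (ball (eRealPt x₀) r) (sectorRegion (slotK k d) (π / 2)) := fun z hz => by
    have h1 := tailC_mem_ball hz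
    rw [tailC_eRealPt] at h1
    have h2 := ball_subset_sectorRegion (K := slotK k d) (u := tailR x₀) hrx h1
    exact ⟨h2.1, h2.2.trans_le (by linarith [Real.pi_pos])⟩
  unfold regG
  exact (differentiableOn_const _).mul ((differentiableOn_logSectorExt 1 hF).comp differentiable_tailC.differentiableOn hsec)

/-- **The densities represent the regularised skeleton distribution** (hypothesis `hdens`): for `ψ`
supported in the real ball,
`T(K_{(N_a)_w} ψ) = ∫ G_a(w, x) ψ(x) dx`. [cite: OsterwalderSchraderCMP1975, Ch. VI.1 (6.8)] -/
theorem skelDist_scaleKernel_skelFamily (hli : LinearIndependent ℝ ê)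
    (a : ℂ × (Fin (k + 2) → 𝓢(EuclideanSpace ℝ (Fin d), ℂ)))
    (hκ : ∀ j, tsupport (a.2 j : EuclideanSpace ℝ (Fin d) → ℂ) ⊆ Metric.closedBall 0 r₀) {w : ℝ} (hw : w ∈ Ioc (0 : ℝ) 1)
    (x₀ : EuclideanSpace ℝ (Fin (k + 2) × Fin d)) {r : ℝ} (hr : 0 < r)
    (hrx : ∀ j, r ≤ tailR x₀ j * Real.sin (π / (4 * (slotK k d + 1))))
    (ψ : 𝓢(EuclideanSpace ℝ (Fin (k + 2) × Fin d), ℂ))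
    (hψ : tsupport (ψ : EuclideanSpace ℝ (Fin (k + 2) × Fin d) → ℂ) ⊆ Metric.ball x₀ r) :
    skelDist 𝔖 ξ ê hli (translationAverage (ContinuousLinearMap.id ℝ _) (scaleKernel w (skelFamily ê hli a)) ψ) =
      ∫ x, regG 𝔖 ξ ê a w (eRealPt x) * ψ x := by
  obtain ⟨c, κ⟩ := a
  obtain ⟨-, -, hreal⟩ := regF_spec 𝔖 hE2 ξ ê hE1 hê1 hêê hξ hg hr₀ hCv hv hM hC₀ hσ κ hκ hw
  have hρ : ∀ j, r ≤ tailR x₀ j := fun j => (tailR_centre_pos hr hrx j).2.le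
  rw [scaleKernel_skelFamily, show skelFamily ê hli (c, fun j => scaleKernel w (κ j)) =
      c • skelKernel ê hli (SchwartzMap.tensorFin (k + 2) (scaledProf κ w)) from rfl,
    translationAverage_id_smul_kernel, map_smul, skelDist_translationAverage_tensor 𝔖 ξ ê hli hE1, smul_eq_mul,
    ← integral_const_mul]
  refine integral_congr_ae (Eventually.of_forall fun x => ?_)
  by_cases hx : x ∈ tsupport (ψ : EuclideanSpace ℝ (Fin (k + 2) × Fin d) → ℂ)
  · have hpos : ∀ j, 0 < tailR x j := tailR_pos_of_mem_ball (hψ hx) hρ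
    simp only [regG]
    rw [tailC_eRealPt, logSectorExt_ofReal 1 hreal hpos, skelSVr, reindexV_tailR]
    ring
  · simp only [image_eq_zero_of_notMem_tsupport hx, mul_zero, zero_mul]

/-- **Joint continuity of the densities in the width and the point** (hypothesis `hcont`): on every
`[ε, 1]` the slot constants are uniform, so the flat-tube family theorem
(`continuousOn_l1TubeExtension_family`, fed through the clamped width `max ε (min w 1)`) and the
continuity of the sector extension give continuity on `[ε, 1] × ball`; as `ε → 0` this exhausts
`(0, 1] × ball`. [folklore] -/
theorem continuousOn_regG (a : ℂ × (Fin (k + 2) → 𝓢(EuclideanSpace ℝ (Fin d), ℂ)))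
    (hκ : ∀ j, tsupport (a.2 j : EuclideanSpace ℝ (Fin d) → ℂ) ⊆ Metric.closedBall 0 r₀)
    (x₀ : EuclideanSpace ℝ (Fin (k + 2) × Fin d)) {r : ℝ}
    (hrx : ∀ j, r ≤ tailR x₀ j * Real.sin (π / (4 * (slotK k d + 1)))) :
    ContinuousOn (fun q : ℝ × (Fin (k + 2) × Fin d → ℂ) => regG 𝔖 ξ ê a q.1 q.2) (Ioc 0 1 ×ˢ ball (eRealPt x₀) r) := by
  obtain ⟨c₀, κ⟩ := a
  -- Step 1: joint continuity of `(w, ζ) ↦ F_w ζ` on `[ε, 1] × tube`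
  have hstep : ∀ ε : ℝ, 0 < ε → ε < 1 →
      ContinuousOn (fun q : ℝ × (Fin (slotK k d + 1) → ℂ) => regF 𝔖 ξ ê κ q.1 q.2)
        (Icc ε 1 ×ˢ {z : Fin (slotK k d + 1) → ℂ | ∑ j, |(z j).im| < π / 2}) := by
    intro ε hε hε1
    set wc : ℝ → ℝ := fun ω => max ε (min ω 1) with hwc
    have hwc_mem : ∀ ω, wc ω ∈ Ioc (0 : ℝ) 1 := fun ω =>
      ⟨hε.trans_le (le_max_left _ _), max_le hε1.le (min_le_right _ _)⟩
    have hwc_ge : ∀ ω, ε ≤ wc ω := fun ω => le_max_left _ _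
    have hwc_cont : Continuous wc := continuous_const.max (continuous_id.min continuous_const)
    have hwc_id : ∀ ω ∈ Icc ε 1, wc ω = ω := fun ω hω => by
      show max ε (min ω 1) = ω
      rw [min_eq_left hω.2, max_eq_right hω.1]
    have hφs : ∀ ω j, tsupport (scaledProf κ (wc ω) j : EuclideanSpace ℝ (Fin d) → ℂ) ⊆ Metric.closedBall 0 r₀ :=
      fun ω => tsupport_scaledProf_subset hr₀ hκ (hwc_mem ω)
    have hfam := continuousOn_l1TubeExtension_family (a := π / 2) (κ := 0) (b := 1) (by positivity) one_pos
      (fun ω => LogSlot.logT (skelSVr 𝔖 (scaledProf κ (wc ω)) ξ ê) 1)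
      (fun ω i θ _ => LogSlot.slotB i 1 (profProd M (scaledProf κ (wc ω)) * unitSlotC ξ ê g Cv M i) (M + M) θ)
      (fun ω i θ => logT_skelSVr_slot 𝔖 hE2 ξ ê hE1 hê1 hêê hξ hg hr₀ (scaledProf κ (wc ω)) (hφs ω) hCv hv hM hC₀ hσ i θ)
      (fun _ => (ε ^ ((d + M) * (k + 2)))⁻¹ * profProd M κ * unitSlotBmax ξ ê g Cv M) (fun _ => 0)
      (fun c _ ω i p => by
        rw [LogSlot.slotB_gaussMod_eq, pow_zero, mul_one]
        refine le_trans (Finset.le_sup' (fun i => LogSlot.slotB i 1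
          (profProd M (scaledProf κ (wc ω)) * unitSlotC ξ ê g Cv M i) (M + M)
          fun _ (s : ℝ) => Complex.exp (-((1 : ℝ) : ℂ) * (s : ℂ) ^ 2)) (Finset.mem_univ i)) ?_
        refine (LogSlot.slotBmax_const_mul_le (profProd_nonneg M _) 1 (unitSlotC ξ ê g Cv M) fun _ => M + M).trans ?_
        exact mul_le_mul_of_nonneg_right (profProd_scaledProf_le_of_le M κ hε (hwc_ge ω) (hwc_mem ω).2)
          (unitSlotBmax_nonneg ξ ê hCv M))
      (fun p => by
        choose θ hθ using fun j => exists_schwartzMap_gaussMod one_pos (p j)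
        have hθfun : (fun j (s : ℝ) => Complex.exp (-((1 : ℝ) : ℂ) * (s : ℂ) ^ 2) *
            Complex.exp (↑(-2 * π * s * p j) * Complex.I)) = fun j => ⇑(θ j) :=
          funext fun j => funext fun s => (hθ j s).symm
        rw [hθfun]
        have h0 := skelQ_nonneg ξ ê s₀
        have hc := LogSlot.continuousOn_logT_param (Ω := ℝ) (T := univ)
          (S := fun ω => skelSVr 𝔖 (scaledProf κ (wc ω)) ξ ê) one_pos
          (fun ω _ => (continuous_skelSV 𝔖 _ ξ ê).comp continuous_reindexV)
          (C := C₀ * skelQ ξ ê s₀ * ((ε ^ ((d + s₀) * (k + 2)))⁻¹ * profProd s₀ κ)) (N := s₀)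
          (fun ω _ u => (norm_skelSVr_le 𝔖 ξ ê _ hC₀ hσ u).trans (by
            have h1 := profProd_scaledProf_le_of_le s₀ κ hε (hwc_ge ω) (hwc_mem ω).2
            gcongr))
          (fun u => ((continuousOn_skelSV_scaleKernel 𝔖 ξ ê κ (reindexV u)).comp_continuous hwc_cont
            fun ω => (hwc_mem ω).1).continuousOn) θ
        exact continuousOn_univ.1 hc)
    refine (hfam.mono (prod_mono (subset_univ _) Subset.rfl)).congr fun q hq => ?_
    show regF 𝔖 ξ ê κ q.1 q.2 = l1TubeExtension 1 (LogSlot.logT (skelSVr 𝔖 (scaledProf κ (wc q.1)) ξ ê) 1) q.2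
    rw [hwc_id q.1 (mem_prod.1 hq).1]
    rfl
  -- Step 2: joint continuity of `G` on `[ε, 1] × ball`
  have hstep2 : ∀ ε : ℝ, 0 < ε → ε < 1 →
      ContinuousOn (fun q : ℝ × (Fin (k + 2) × Fin d → ℂ) => regG 𝔖 ξ ê (c₀, κ) q.1 q.2)
        (Icc ε 1 ×ˢ ball (eRealPt x₀) r) := by
    intro ε hε hε1
    have hls := continuousOn_logSectorExt_param (Ω := ℝ) 1 (F := regF 𝔖 ξ ê κ) (c := π / 2) (T := Icc ε 1)
      (hstep ε hε hε1)
    have hmaps : MapsTo (fun q : ℝ × (Fin (k + 2) × Fin d → ℂ) => (q.1, tailC q.2)) (Icc ε 1 ×ˢ ball (eRealPt x₀) r)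
        (Icc ε 1 ×ˢ sectorRegion (slotK k d) (π / 2)) := fun q hq => by
      refine ⟨(mem_prod.1 hq).1, ?_⟩
      have h1 := tailC_mem_ball (mem_prod.1 hq).2
      rw [tailC_eRealPt] at h1
      have h2 := ball_subset_sectorRegion (K := slotK k d) (u := tailR x₀) hrx h1
      exact ⟨h2.1, h2.2.trans_le (by linarith [Real.pi_pos])⟩
    have hcomp := hls.comp (continuous_fst.prodMk (continuous_tailC.comp continuous_snd)).continuousOn hmaps
    exact continuousOn_const.mul hcomp
  -- Step 3: exhaust `(0, 1]`
  rintro ⟨w, z⟩ hq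
  obtain ⟨⟨hw0, hw1⟩, hz⟩ := mem_prod.1 hq
  have h := (hstep2 (w / 2) (by linarith) (by linarith)) (w, z) (mk_mem_prod ⟨by linarith, hw1⟩ hz)
  refine h.mono_of_mem_nhdsWithin (mem_nhdsWithin.2 ⟨Ioi (w / 2) ×ˢ univ, isOpen_Ioi.prod isOpen_univ,
    mk_mem_prod (show w / 2 < w by linarith) (mem_univ _), ?_⟩)
  rintro q ⟨hq1, hq2⟩
  exact mk_mem_prod ⟨le_of_lt (mem_prod.1 hq1).1, (mem_prod.1 hq2).1.2⟩ (mem_prod.1 hq2).2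

end Regularised

/-! ### The holomorphic density of the skeleton distribution -/

section Main

variable [NeZero d] (𝔖 : SchwingerFamily (EuclideanSpace ℝ (Fin d))) (hE1 : 𝔖.IsEuclideanCovariant)
  (hE2 : 𝔖.IsOSReflectionPositive) (hE0 : 𝔖.HasLinearGrowth) {k : ℕ}
  (ξ : Fin (k + 1) → EuclideanSpace ℝ (Fin d)) (ê : Fin d → EuclideanSpace ℝ (Fin d)) (hli : LinearIndependent ℝ ê)
  {g r₀ : ℝ} (hê1 : ∀ μ, ‖ê μ‖ = 1) (hêê : ∀ μ ν, 0 ≤ ⟪ê μ, ê ν⟫) (hξ : ∀ μ i', g ≤ ⟪ê μ, ξ i'⟫)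
  (hg : 2 * r₀ < g) (hr₀ : 0 < r₀)

omit [NeZero d] in
/-- **The admissible indices** of the kernel family: a scalar and a profile tuple supported in
`B̄(0, r₀)`. [folklore] -/
abbrev AdmIdx (k d : ℕ) (r₀ : ℝ) : Type :=
  {a : ℂ × (Fin (k + 2) → 𝓢(EuclideanSpace ℝ (Fin d), ℂ)) //
    ∀ j, tsupport (a.2 j : EuclideanSpace ℝ (Fin d) → ℂ) ⊆ Metric.closedBall 0 r₀}

omit [NeZero d] in
/-- **The binary splitting on admissible indices** (`skelSplit` keeps the supports). [folklore] -/
def admSplit (p : Fin (k + 2) × Fin d) (a : AdmIdx k d r₀) : AdmIdx k d r₀ × AdmIdx k d r₀ :=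
  (⟨(skelSplit ê hli p a.1).1, (tsupport_skelSplit_subset ê hli p a.1 a.2).1⟩,
    ⟨(skelSplit ê hli p a.1).2, (tsupport_skelSplit_subset ê hli p a.1 a.2).2⟩)

include hE1 hE2 hE0 hê1 hêê hξ hg hr₀

/-- **The skeleton distribution has a holomorphic density near every parameter point with positive
directional coordinates** (Osterwalder–Schrader II, Thm. 4.1 for the skeleton, pointwise, Method B
with the removal of the regularisation of Ch. VI.1 done by analytic deconvolution): for
`x₀ ∈ ℝ^{(k+2)d}` and `0 < r ≤ (tail x₀)ⱼ sin(π/(4(k+1)d))`, there is `H` holomorphic on the complex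
ball `B(x₀, r/2)`, bounded there, with `T ψ = ∫ H(x) ψ(x) dx` for every `ψ` supported in the real
ball `B(x₀, r/2)`, `T = 𝔖_{k+2} ∘ skelPullback`. [cite: OsterwalderSchraderCMP1975, Thm. 4.1, Ch. V.1 (5.8), Ch. VI.1 (6.5)–(6.13)] -/
theorem exists_holomorphic_density_skelDist (x₀ : EuclideanSpace ℝ (Fin (k + 2) × Fin d)) {r : ℝ} (hr : 0 < r)
    (hrx : ∀ j, r ≤ tailR x₀ j * Real.sin (π / (4 * (slotK k d + 1)))) :
    ∃ H : (Fin (k + 2) × Fin d → ℂ) → ℂ, DifferentiableOn ℂ H (ball (eRealPt x₀) (r / 2)) ∧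
      (∃ B : ℝ, ∀ z ∈ ball (eRealPt x₀) (r / 2), ‖H z‖ ≤ B) ∧
      ∀ ψ : 𝓢(EuclideanSpace ℝ (Fin (k + 2) × Fin d), ℂ),
        tsupport (ψ : EuclideanSpace ℝ (Fin (k + 2) × Fin d) → ℂ) ⊆ Metric.ball x₀ (r / 2) →
          skelDist 𝔖 ξ ê hli ψ = ∫ x, H (eRealPt x) * ψ x := by
  classical
  -- the E0' constants
  obtain ⟨s, Cv, hCv, hv⟩ := exists_norm_ι_δ_le_of_hasLinearGrowth 𝔖 hE2 hE0
  obtain ⟨s', σ, α', β', -, hσ⟩ := hE0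
  have hσ' : ∀ F : 𝓢((Fin (k + 2) → EuclideanSpace ℝ (Fin d)), ℂ),
      ‖𝔖 (k + 2) F‖ ≤ |σ (k + 2)| * schwartzNorm ((k + 2) * s') F := fun F =>
    (hσ (k + 2) F).trans (mul_le_mul_of_nonneg_right (le_abs_self _) (QuantumLattice.schwartzNorm_nonneg _ _))
  have hC₀ : 0 ≤ |σ (k + 2)| := abs_nonneg _
  have hM : (k + 1 + (k + 1)) * s ≤ (k + 1 + (k + 1)) * s := le_rfl
  -- the kernel family and its splitting
  set Nk : AdmIdx k d r₀ → 𝓢(EuclideanSpace ℝ (Fin (k + 2) × Fin d), ℂ) := fun a => skelFamily ê hli a.1 with hNk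
  have hX : ∀ (p : Fin (k + 2) × Fin d) (a : AdmIdx k d r₀),
      coordMul (EuclideanSpace.basisFun (Fin (k + 2) × Fin d) ℝ p) (Nk a) =
        Nk (admSplit ê hli p a).1 + Nk (admSplit ê hli p a).2 := fun p a => by
    simp only [hNk, admSplit]
    rw [show (EuclideanSpace.basisFun (Fin (k + 2) × Fin d) ℝ) p = EuclideanSpace.single p (1 : ℝ) by simp]
    exact coordMul_skelFamily ê hli p a.1
  have hsupp : ∀ a : AdmIdx k d r₀, tsupport (Nk a : EuclideanSpace ℝ (Fin (k + 2) × Fin d) → ℂ) ⊆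
      closedBall 0 (‖((posLinCLE (k := k) ê hli).symm).toContinuousLinearMap‖ * r₀) :=
    fun a => tsupport_skelFamily_subset ê hli hr₀.le a.1 a.2
  -- the densities and their constants
  have hcont : ∀ a : AdmIdx k d r₀, ContinuousOn (fun q : ℝ × (Fin (k + 2) × Fin d → ℂ) => regG 𝔖 ξ ê a.1 q.1 q.2)
      (Ioc 0 1 ×ˢ ball (eRealPt x₀) r) := fun a =>
    continuousOn_regG 𝔖 hE2 ξ ê hE1 hê1 hêê hξ hg hr₀.le hCv hv hM hC₀ hσ' a.1 a.2 x₀ hrx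
  have hdiff : ∀ a : AdmIdx k d r₀, ∀ w ∈ Ioc (0 : ℝ) 1, DifferentiableOn ℂ (regG 𝔖 ξ ê a.1 w) (ball (eRealPt x₀) r) :=
    fun a w hw => differentiableOn_regG 𝔖 hE2 ξ ê hE1 hê1 hêê hξ hg hr₀.le hCv hv hM hC₀ hσ' a.1 a.2 hw x₀ hrx
  have hbd : ∀ a : AdmIdx k d r₀, ∀ w ∈ Ioc (0 : ℝ) 1, ∀ z ∈ ball (eRealPt x₀) r,
      ‖regG 𝔖 ξ ê a.1 w z‖ ≤ regC ξ ê g Cv ((k + 1 + (k + 1)) * s) x₀ r a.1 *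
        (w ^ ((d + (k + 1 + (k + 1)) * s) * (k + 2)))⁻¹ :=
    fun a w hw z hz => norm_regG_le 𝔖 hE2 ξ ê hE1 hê1 hêê hξ hg hr₀.le hCv hv hM hC₀ hσ' a.1 a.2 hw x₀ hr hrx hz
  have hC : ∀ a : AdmIdx k d r₀, 0 ≤ regC ξ ê g Cv ((k + 1 + (k + 1)) * s) x₀ r a.1 :=
    fun a => regC_nonneg ξ ê hCv _ x₀ r a.1
  have hdens : ∀ a : AdmIdx k d r₀, ∀ w ∈ Ioc (0 : ℝ) 1, ∀ ψ : 𝓢(EuclideanSpace ℝ (Fin (k + 2) × Fin d), ℂ),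
      tsupport (ψ : EuclideanSpace ℝ (Fin (k + 2) × Fin d) → ℂ) ⊆ Metric.ball x₀ r →
        skelDist 𝔖 ξ ê hli (translationAverage (ContinuousLinearMap.id ℝ _) (scaleKernel w (Nk a)) ψ) =
          ∫ x, regG 𝔖 ξ ê a.1 w (eRealPt x) * ψ x :=
    fun a w hw ψ hψ => skelDist_scaleKernel_skelFamily 𝔖 hE2 ξ ê hE1 hê1 hêê hξ hg hr₀.le hCv hv hM hC₀ hσ' hli
      a.1 a.2 hw x₀ hr hrx ψ hψ
  -- a kernel of the family of mass one: normalised bumps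
  let χ : ContDiffBump (0 : EuclideanSpace ℝ (Fin d)) := ⟨r₀ / 2, r₀, by positivity, by linarith⟩
  have hχC : ContDiff ℝ (⊤ : ℕ∞) (fun x => (χ x : ℂ)) := Complex.ofRealCLM.contDiff.comp χ.contDiff
  have hχc : HasCompactSupport (fun x => (χ x : ℂ)) := χ.hasCompactSupport.comp_left Complex.ofReal_zero
  set κ₀ : 𝓢(EuclideanSpace ℝ (Fin d), ℂ) := hχc.toSchwartzMap hχC with hκ₀
  have hκ₀_apply : ∀ x, κ₀ x = (χ x : ℂ) := fun x => rfl
  have hκ₀supp : tsupport (κ₀ : EuclideanSpace ℝ (Fin d) → ℂ) ⊆ Metric.closedBall 0 r₀ := by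
    rw [show (κ₀ : EuclideanSpace ℝ (Fin d) → ℂ) = Complex.ofReal ∘ χ from funext hκ₀_apply]
    refine (closure_mono (Function.support_comp_subset Complex.ofReal_zero χ)).trans (le_of_eq ?_)
    exact χ.tsupport_eq
  set a₁ : AdmIdx k d r₀ := ⟨(1, fun _ => κ₀), fun _ => hκ₀supp⟩ with ha₁
  set gfun : EuclideanSpace ℝ (Fin (k + 2) × Fin d) → ℝ := fun U => ∏ j, χ (posLinCLE ê hli U j) with hgfun
  have hNk1 : ∀ U, Nk a₁ U = ((gfun U : ℝ) : ℂ) := fun U => by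
    rw [hNk, ha₁, hgfun]
    simp only [skelFamily_apply, hκ₀_apply, one_mul, Complex.ofReal_prod]
  have hg0 : 0 ≤ gfun := fun U => Finset.prod_nonneg fun j _ => χ.nonneg
  have hgc : Continuous gfun :=
    continuous_finsetProd _ fun j _ => χ.continuous.comp ((continuous_apply j).comp (posLinCLE ê hli).continuous)
  have hgi : Integrable gfun := by
    refine ((Nk a₁).integrable.re).congr (Eventually.of_forall fun U => ?_)
    simp [hNk1 U]
  have hg1 : gfun 0 ≠ 0 := by
    have h1 : ∀ j : Fin (k + 2), χ (posLinCLE ê hli 0 j) = 1 := fun j => by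
      rw [map_zero, Pi.zero_apply]
      exact χ.one_of_mem_closedBall (Metric.mem_closedBall_self χ.rIn_pos.le)
    rw [hgfun]
    simp only [Finset.prod_eq_one fun j _ => h1 j]
    exact one_ne_zero
  have hgpos : 0 < ∫ U, gfun U := by
    rw [integral_pos_iff_support_of_nonneg hg0 hgi]
    exact hgc.isOpen_support.measure_pos volume ⟨0, hg1⟩
  set m : ℂ := ∫ U, Nk a₁ U with hm
  have hm_eq : m = ((∫ U, gfun U : ℝ) : ℂ) := by
    rw [hm]; simp_rw [hNk1]; exact integral_ofReal
  have hm0 : m ≠ 0 := by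
    rw [hm_eq]; exact_mod_cast hgpos.ne'
  set a₀ : AdmIdx k d r₀ := ⟨(m⁻¹, fun _ => κ₀), fun _ => hκ₀supp⟩ with ha₀
  have hmass : ∫ U, Nk a₀ U = 1 := by
    have h1 : ∀ U, Nk a₀ U = m⁻¹ * Nk a₁ U := fun U => by
      rw [hNk, ha₀, ha₁]
      simp only [skelFamily_apply, one_mul]
    simp_rw [h1]
    rw [integral_const_mul, ← hm, inv_mul_cancel₀ hm0]
  -- analytic deconvolution
  obtain ⟨H, hH, hHb, hHT⟩ := exists_holomorphic_density_of_scaled_regularisations Nk (admSplit ê hli)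
    (G := fun a => regG 𝔖 ξ ê a.1) (C := fun a => regC ξ ê g Cv ((k + 1 + (k + 1)) * s) x₀ r a.1)
    hX hr hsupp hcont hdiff hbd hC hdens a₀ hmass
  exact ⟨H, hH, ⟨_, hHb⟩, hHT⟩

end Main

end Literature.MathematicalPhysics.QuantumFieldTheory
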